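import Literature.Probability.LatticeModels.BesselSaddleInterpolation
import Mathlib.Analysis.SpecialFunctions.Gaussian.GaussianIntegral
import Mathlib.Analysis.SpecialFunctions.Trigonometric.Bounds
import Mathlib.Analysis.Complex.ExponentialBounds
import Mathlib.Analysis.Real.Pi.Bounds
import HarnessLib

/-!
# Uniform bounds on the saddle-point amplitude and positivity of the Bessel interpolation
# (FS81 App. B (B.5)–(B.10), property (b))

Support file of the proof programme of the named fact
`Literature.MathematicalPhysics.QuantumFieldTheory.FrohlichSpencerU1PerimeterLawD4` (Wilson-action
step, FS82 p. 433 / FS81 Appendix B); sequel of `BesselSaddleInterpolation`, where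
`besselInterp β φ = exp(F_β(φ)) · amp β φ` with the amplitude
`amp β φ = (2π)⁻¹ ∫_{-π}^{π} e^{-B(1 - cos θ)} cos(φ(θ - sin θ)) dθ`, `B = √(β² + φ²)`.

FS81 App. B evaluates the saddle-point integral asymptotically "by using the method of steepest
descent": the range of integration is broken up into `|θ| ≤ π/2` and the rest, where `cos θ ≤ 0`
((B.5)), the variable is rescaled by `σ = (β cosh τ)^{1/2}` ((B.6)–(B.7)), and Taylor's theorem
with remainder extracts the leading Gaussian contribution `(2π)^{1/2}(1 + O(σ^{-2}))` ((B.8)–(B.10)),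
UNIFORMLY in the order `n` — the point being that at the saddle the oscillation `e^{inθ³h(θ)}`
is slow on the scale `σ⁻¹` of the Gaussian, because `|n| θ³ ≲ |n| σ^{-3} ≤ σ⁻¹`. This file proves
the uniform two-sided estimate that this argument yields, with explicit constants, and deduces
the positivity of the interpolation (property (b) of FS81 §6) for `β ≥ 200`:

* `ampMax β φ = (2π)⁻¹ ∫_{-π}^{π} e^{-B(1-cos θ)} dθ` (`= e^{-B} I₀(B)`), `amp_le_ampMax`
  (`cos ≤ 1`), and the lower bound `ampMax_ge : e^{-1/2}/(π √B) ≤ ampMax` (`B ≥ 1`; restrict to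
  `|θ| ≤ B^{-1/2}`);
* the elementary inequalities `sub_sin_le_cube` (`0 ≤ θ - sin θ ≤ θ³/6`), `abs_sub_sin_le`,
  `one_sub_cos_ge` (Jordan: `2θ²/π² ≤ 1 - cos θ` on `[-π, π]`, Mathlib
  `Real.cos_le_one_sub_mul_cos_sq`), `pow_six_mul_exp_neg_le` (`θ⁶ e^{-aθ²} ≤ (6/(ae))³ e^{-aθ²/2}`);
* `ampMax_sub_amp_le` — **the deficit bound**
  `0 ≤ ampMax - amp ≤ (2π)⁻¹ (φ²/72) (3π²/(eB))³ √(π³/B)` (so `= O(φ² B^{-7/2}) = O(B^{-3/2})`);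
* `half_ampMax_le_amp` (`β ≥ 200`): `ampMax/2 ≤ amp`, whence **`amp_pos`** and
  **`besselInterp_pos`** (property (b): `I_β(φ) > 0` for all real `φ`, `β ≥ 200`), together with the
  two-sided estimate `e^{-1/2}/(2π√B) ≤ amp ≤ ampMax`.

Everything is proved; no named fact is introduced.

## References

* J. Fröhlich, T. Spencer, Comm. Math. Phys. 81 (1981) 527–602, Appendix B (B.5)–(B.10), §6
  property (b). [FrohlichSpencerKT1981]
* J. Fröhlich, T. Spencer, Comm. Math. Phys. 83 (1982) 411–454, p. 433. [FrohlichSpencerCMP1982]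
-/

noncomputable section

open MeasureTheory Real Filter intervalIntegral Set
open scoped Topology

namespace Literature.Probability.LatticeModels

namespace BesselInterp

/-! ### Elementary inequalities -/

/-- `0 ≤ θ - sin θ ≤ θ³/6` for `θ ≥ 0` (integrate `0 ≤ 1 - cos t ≤ t²/2`). [folklore] -/
theorem sub_sin_le_cube {θ : ℝ} (hθ : 0 ≤ θ) : 0 ≤ θ - Real.sin θ ∧ θ - Real.sin θ ≤ θ ^ 3 / 6 := by
  have h1 : θ - Real.sin θ = ∫ t in (0:ℝ)..θ, (1 - Real.cos t) := by
    rw [intervalIntegral.integral_sub intervalIntegrable_const (Real.continuous_cos.intervalIntegrable _ _),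
      intervalIntegral.integral_const, integral_cos, smul_eq_mul, mul_one, Real.sin_zero, sub_zero, sub_zero]
  have h2 : θ ^ 3 / 6 = ∫ t in (0:ℝ)..θ, t ^ 2 / 2 := by
    rw [intervalIntegral.integral_div, integral_pow]
    ring
  constructor
  · rw [h1]
    exact intervalIntegral.integral_nonneg hθ fun t _ => by linarith [Real.cos_le_one t]
  · rw [h1, h2]
    refine intervalIntegral.integral_mono_on hθ ?_ ?_ fun t _ => ?_
    · exact (continuous_const.sub Real.continuous_cos).intervalIntegrable _ _
    · exact ((continuous_pow 2).div_const _).intervalIntegrable _ _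
    · linarith [Real.one_sub_sq_div_two_le_cos (x := t)]

/-- `|θ - sin θ| ≤ |θ|³/6` for all real `θ`. [folklore] -/
theorem abs_sub_sin_le (θ : ℝ) : |θ - Real.sin θ| ≤ |θ| ^ 3 / 6 := by
  rcases le_or_gt 0 θ with h | h
  · obtain ⟨h0, h1⟩ := sub_sin_le_cube h
    rw [abs_of_nonneg h0, abs_of_nonneg h]
    exact h1
  · obtain ⟨h0, h1⟩ := sub_sin_le_cube (neg_nonneg.2 h.le)
    rw [Real.sin_neg] at h0 h1
    rw [abs_of_nonpos (by linarith), abs_of_neg h]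
    linarith

/-- Jordan's inequality for the cosine: `2θ²/π² ≤ 1 - cos θ` on `[-π, π]`. [folklore] -/
theorem one_sub_cos_ge {θ : ℝ} (hθ : |θ| ≤ π) : 2 / π ^ 2 * θ ^ 2 ≤ 1 - Real.cos θ := by
  linarith [Real.cos_le_one_sub_mul_cos_sq hθ]

/-- `1 - cos u ≤ u²/2`. [folklore] -/
theorem one_sub_cos_le (u : ℝ) : 1 - Real.cos u ≤ u ^ 2 / 2 := by
  linarith [Real.one_sub_sq_div_two_le_cos (x := u)]

/-- `y³ ≤ (3/e)³ e^y` for `y ≥ 0` (from `e·t ≤ e^t`). [folklore] -/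
theorem cube_le_mul_exp {y : ℝ} (hy : 0 ≤ y) : y ^ 3 ≤ (3 / Real.exp 1) ^ 3 * Real.exp y := by
  have h1 : Real.exp 1 * (y / 3) ≤ Real.exp (y / 3) := by
    have := Real.add_one_le_exp (y / 3 - 1)
    rw [Real.exp_sub] at this
    have he : 0 < Real.exp 1 := Real.exp_pos 1
    rw [le_div_iff₀ he] at this
    linarith
  have h0 : 0 ≤ Real.exp 1 * (y / 3) := by positivity
  have h2 := pow_le_pow_left₀ h0 h1 3
  rw [← Real.exp_nat_mul] at h2
  have h3 : ((3 : ℕ) : ℝ) * (y / 3) = y := by push_cast; ring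
  rw [h3, mul_pow] at h2
  have he : 0 < Real.exp 1 := Real.exp_pos 1
  have he3 : 0 < Real.exp 1 ^ 3 := by positivity
  rw [div_pow, div_mul_eq_mul_div, le_div_iff₀ he3]
  calc y ^ 3 * Real.exp 1 ^ 3 = Real.exp 1 ^ 3 * (y / 3) ^ 3 * 3 ^ 3 := by ring
    _ ≤ Real.exp y * 3 ^ 3 := by nlinarith
    _ = 3 ^ 3 * Real.exp y := by ring

/-- `θ⁶ e^{-aθ²} ≤ (6/(ae))³ e^{-aθ²/2}` for `a > 0`. [folklore] -/
theorem pow_six_mul_exp_neg_le {a : ℝ} (ha : 0 < a) (θ : ℝ) :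
    θ ^ 6 * Real.exp (-a * θ ^ 2) ≤ (6 / (a * Real.exp 1)) ^ 3 * Real.exp (-(a / 2) * θ ^ 2) := by
  have hy : 0 ≤ a / 2 * θ ^ 2 := by positivity
  have h := cube_le_mul_exp hy
  -- `(a/2 θ²)³ ≤ (3/e)³ e^{aθ²/2}`, i.e. `θ⁶ ≤ (6/(ae))³ e^{aθ²/2}`
  have h2 : θ ^ 6 ≤ (6 / (a * Real.exp 1)) ^ 3 * Real.exp (a / 2 * θ ^ 2) := by
    have ha3 : 0 < (a / 2) ^ 3 := by positivity
    have heq : θ ^ 6 = (a / 2 * θ ^ 2) ^ 3 / (a / 2) ^ 3 := by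
      field_simp
    rw [heq, div_le_iff₀ ha3]
    calc (a / 2 * θ ^ 2) ^ 3 ≤ (3 / Real.exp 1) ^ 3 * Real.exp (a / 2 * θ ^ 2) := h
      _ = (6 / (a * Real.exp 1)) ^ 3 * Real.exp (a / 2 * θ ^ 2) * (a / 2) ^ 3 := by
          have he : Real.exp 1 ≠ 0 := (Real.exp_pos 1).ne'
          field_simp
          ring
  calc θ ^ 6 * Real.exp (-a * θ ^ 2)
      ≤ (6 / (a * Real.exp 1)) ^ 3 * Real.exp (a / 2 * θ ^ 2) * Real.exp (-a * θ ^ 2) :=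
        mul_le_mul_of_nonneg_right h2 (Real.exp_nonneg _)
    _ = (6 / (a * Real.exp 1)) ^ 3 * (Real.exp (a / 2 * θ ^ 2) * Real.exp (-a * θ ^ 2)) := by ring
    _ = (6 / (a * Real.exp 1)) ^ 3 * Real.exp (-(a / 2) * θ ^ 2) := by
        rw [← Real.exp_add]; congr 2; ring

/-! ### The maximal amplitude and its lower bound -/

/-- The amplitude at zero phase: `ampMax β φ = (2π)⁻¹ ∫_{-π}^{π} e^{-B(φ)(1 - cos θ)} dθ`
(`= e^{-B} I₀(B)`). [cite: FrohlichSpencerKT1981, App. B (B.9)] -/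
def ampMax (β φ : ℝ) : ℝ := (2 * π)⁻¹ * ∫ θ in (-π)..π, Real.exp (-(bigB β φ) * (1 - Real.cos θ))

/-- `amp ≤ ampMax` (`cos ≤ 1`). [folklore] -/
theorem amp_le_ampMax (β φ : ℝ) : amp β φ ≤ ampMax β φ := by
  unfold amp ampMax
  refine mul_le_mul_of_nonneg_left ?_ (by positivity)
  refine intervalIntegral.integral_mono_on (by linarith [Real.pi_pos]) ?_ ?_ fun θ _ => ?_
  · exact (by fun_prop : Continuous fun θ => Real.exp (-(bigB β φ) * (1 - Real.cos θ)) *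
      Real.cos (φ * (θ - Real.sin θ))).intervalIntegrable _ _
  · exact (by fun_prop : Continuous fun θ => Real.exp (-(bigB β φ) * (1 - Real.cos θ))).intervalIntegrable _ _
  · have h := Real.cos_le_one (φ * (θ - Real.sin θ))
    have he := Real.exp_nonneg (-(bigB β φ) * (1 - Real.cos θ))
    nlinarith

/-- **Lower bound on the maximal amplitude**: `e^{-1/2}/(π √B) ≤ ampMax` for `B ≥ 1` (restrict the
integral to `|θ| ≤ B^{-1/2}`, where `B(1 - cos θ) ≤ Bθ²/2 ≤ 1/2`). [cite: FrohlichSpencerKT1981, App. B (B.9)–(B.10)] -/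
theorem ampMax_ge {β φ : ℝ} (hB : 1 ≤ bigB β φ) :
    Real.exp (-(1 / 2)) / (π * Real.sqrt (bigB β φ)) ≤ ampMax β φ := by
  set B := bigB β φ with hBdef
  have hBpos : 0 < B := by linarith
  set δ := (Real.sqrt B)⁻¹ with hδ
  have hδpos : 0 < δ := inv_pos.2 (Real.sqrt_pos.2 hBpos)
  have hδle : δ ≤ 1 := by
    rw [hδ, inv_le_one_iff₀]
    exact Or.inr (Real.one_le_sqrt.2 hB)
  have hδπ : δ ≤ π := hδle.trans (by linarith [Real.pi_gt_three])
  have hδsq : δ ^ 2 * B = 1 := by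
    rw [hδ, inv_pow, Real.sq_sqrt hBpos.le, inv_mul_cancel₀ hBpos.ne']
  set f : ℝ → ℝ := fun θ => Real.exp (-B * (1 - Real.cos θ)) with hf
  have hfc : Continuous f := by simp only [hf]; fun_prop
  have hf0 : ∀ θ, 0 ≤ f θ := fun θ => Real.exp_nonneg _
  -- restrict to `[-δ, δ]`
  have hsub : ∫ θ in (-δ)..δ, f θ ≤ ∫ θ in (-π)..π, f θ := by
    rw [intervalIntegral.integral_of_le (by linarith), intervalIntegral.integral_of_le (by linarith [Real.pi_pos])]
    exact setIntegral_mono_set hfc.integrableOn_Ioc (Eventually.of_forall hf0)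
      (Eventually.of_forall (Set.Ioc_subset_Ioc (by linarith) hδπ))
  -- on `[-δ, δ]` the integrand is at least `e^{-1/2}`
  have hlow : ∫ θ in (-δ)..δ, Real.exp (-(1 / 2)) ≤ ∫ θ in (-δ)..δ, f θ := by
    refine intervalIntegral.integral_mono_on (by linarith) intervalIntegrable_const (hfc.intervalIntegrable _ _)
      fun θ hθ => ?_
    simp only [hf]
    refine Real.exp_le_exp.2 ?_
    have h1 : 1 - Real.cos θ ≤ θ ^ 2 / 2 := one_sub_cos_le θ
    have h2 : θ ^ 2 ≤ δ ^ 2 := by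
      rw [sq_le_sq, abs_of_pos hδpos]
      exact abs_le.2 ⟨hθ.1, hθ.2⟩
    nlinarith
  rw [intervalIntegral.integral_const, smul_eq_mul, show δ - -δ = 2 * δ by ring] at hlow
  have hπ : 0 < 2 * π := by positivity
  calc Real.exp (-(1 / 2)) / (π * Real.sqrt B) = (2 * π)⁻¹ * (2 * δ * Real.exp (-(1 / 2))) := by
        rw [hδ]; field_simp
    _ ≤ (2 * π)⁻¹ * ∫ θ in (-π)..π, f θ :=
        mul_le_mul_of_nonneg_left (hlow.trans hsub) (by positivity)

/-! ### The deficit bound -/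

/-- The pointwise bound on the deficit integrand:
`e^{-B(1-cos θ)}(1 - cos(φ(θ - sin θ))) ≤ (φ²/72) θ⁶ e^{-(2B/π²) θ²}` on `[-π, π]`.
[cite: FrohlichSpencerKT1981, App. B (B.5)–(B.8)] -/
theorem deficit_integrand_le {β : ℝ} (hβ : 0 ≤ β) (φ : ℝ) {θ : ℝ} (hθ : |θ| ≤ π) :
    Real.exp (-(bigB β φ) * (1 - Real.cos θ)) * (1 - Real.cos (φ * (θ - Real.sin θ))) ≤
      φ ^ 2 / 72 * (θ ^ 6 * Real.exp (-(2 * bigB β φ / π ^ 2) * θ ^ 2)) := by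
  have hB : 0 ≤ bigB β φ := (le_bigB hβ φ).trans' hβ
  have h1 : 1 - Real.cos (φ * (θ - Real.sin θ)) ≤ φ ^ 2 / 72 * θ ^ 6 := by
    have h := one_sub_cos_le (φ * (θ - Real.sin θ))
    have hs := abs_sub_sin_le θ
    have hs0 : 0 ≤ |θ - Real.sin θ| := abs_nonneg _
    have h3 : (θ - Real.sin θ) ^ 2 ≤ (|θ| ^ 3 / 6) ^ 2 := by
      rw [← sq_abs (θ - Real.sin θ)]
      exact pow_le_pow_left₀ hs0 hs 2
    have h4 : (|θ| ^ 3 / 6) ^ 2 = θ ^ 6 / 36 := by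
      rw [div_pow, show |θ| ^ 3 = |θ ^ 3| by rw [abs_pow], sq_abs]; ring
    calc 1 - Real.cos (φ * (θ - Real.sin θ)) ≤ (φ * (θ - Real.sin θ)) ^ 2 / 2 := h
      _ = φ ^ 2 * (θ - Real.sin θ) ^ 2 / 2 := by ring
      _ ≤ φ ^ 2 * (θ ^ 6 / 36) / 2 := by gcongr; rwa [h4] at h3
      _ = φ ^ 2 / 72 * θ ^ 6 := by ring
  have h2 : Real.exp (-(bigB β φ) * (1 - Real.cos θ)) ≤ Real.exp (-(2 * bigB β φ / π ^ 2) * θ ^ 2) := by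
    refine Real.exp_le_exp.2 ?_
    have hj := one_sub_cos_ge hθ
    have : bigB β φ * (2 / π ^ 2 * θ ^ 2) ≤ bigB β φ * (1 - Real.cos θ) := mul_le_mul_of_nonneg_left hj hB
    calc -(bigB β φ) * (1 - Real.cos θ) ≤ -(bigB β φ * (2 / π ^ 2 * θ ^ 2)) := by linarith
      _ = -(2 * bigB β φ / π ^ 2) * θ ^ 2 := by ring
  have h0 : 0 ≤ 1 - Real.cos (φ * (θ - Real.sin θ)) := by linarith [Real.cos_le_one (φ * (θ - Real.sin θ))]
  calc Real.exp (-(bigB β φ) * (1 - Real.cos θ)) * (1 - Real.cos (φ * (θ - Real.sin θ)))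
      ≤ Real.exp (-(2 * bigB β φ / π ^ 2) * θ ^ 2) * (φ ^ 2 / 72 * θ ^ 6) :=
        mul_le_mul h2 h1 h0 (Real.exp_nonneg _)
    _ = φ ^ 2 / 72 * (θ ^ 6 * Real.exp (-(2 * bigB β φ / π ^ 2) * θ ^ 2)) := by ring

/-- The deficit as an integral. [folklore] -/
theorem ampMax_sub_amp (β φ : ℝ) : ampMax β φ - amp β φ =
    (2 * π)⁻¹ * ∫ θ in (-π)..π, Real.exp (-(bigB β φ) * (1 - Real.cos θ)) * (1 - Real.cos (φ * (θ - Real.sin θ))) := by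
  unfold ampMax amp
  rw [← mul_sub, ← intervalIntegral.integral_sub]
  · congr 1
    refine intervalIntegral.integral_congr fun θ _ => ?_
    ring
  · exact (by fun_prop : Continuous fun θ => Real.exp (-(bigB β φ) * (1 - Real.cos θ))).intervalIntegrable _ _
  · exact (by fun_prop : Continuous fun θ => Real.exp (-(bigB β φ) * (1 - Real.cos θ)) *
      Real.cos (φ * (θ - Real.sin θ))).intervalIntegrable _ _

/-- The deficit is non-negative. [folklore] -/
theorem amp_le_ampMax' (β φ : ℝ) : 0 ≤ ampMax β φ - amp β φ := by linarith [amp_le_ampMax β φ]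

/-- **The deficit bound** (the uniform steepest-descent estimate):
`ampMax - amp ≤ (2π)⁻¹ · (φ²/72) · (6/(a e))³ · √(2π/a)` with `a = 2B/π²`, i.e. `O(φ² B^{-7/2})`.
[cite: FrohlichSpencerKT1981, App. B (B.5)–(B.10)] -/
theorem ampMax_sub_amp_le {β : ℝ} (hβ : 0 < β) (φ : ℝ) :
    ampMax β φ - amp β φ ≤ (2 * π)⁻¹ * (φ ^ 2 / 72 * ((6 / (2 * bigB β φ / π ^ 2 * Real.exp 1)) ^ 3 *
      Real.sqrt (π / (2 * bigB β φ / π ^ 2 / 2)))) := by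
  set B := bigB β φ with hBdef
  have hBpos : 0 < B := bigB_pos hβ φ
  set a := 2 * B / π ^ 2 with ha
  have hapos : 0 < a := by positivity
  rw [ampMax_sub_amp]
  refine mul_le_mul_of_nonneg_left ?_ (by positivity)
  -- the integrand is dominated by `(φ²/72) θ⁶ e^{-aθ²} ≤ (φ²/72)(6/(ae))³ e^{-aθ²/2}`, integrable on `ℝ`
  set g : ℝ → ℝ := fun θ => φ ^ 2 / 72 * ((6 / (a * Real.exp 1)) ^ 3 * Real.exp (-(a / 2) * θ ^ 2)) with hg
  have hgi : Integrable g := by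
    simp only [hg]
    exact ((integrable_exp_neg_mul_sq (by positivity : 0 < a / 2)).const_mul _).const_mul _
  have hle : -π ≤ π := by linarith [Real.pi_pos]
  have hpt : ∀ θ ∈ Set.Ioc (-π) π, Real.exp (-B * (1 - Real.cos θ)) * (1 - Real.cos (φ * (θ - Real.sin θ))) ≤ g θ := by
    intro θ hθ
    have habs : |θ| ≤ π := abs_le.2 ⟨hθ.1.le, hθ.2⟩
    refine (deficit_integrand_le hβ.le φ habs).trans ?_
    simp only [hg]
    refine mul_le_mul_of_nonneg_left ?_ (by positivity)
    have := pow_six_mul_exp_neg_le hapos θ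
    rwa [ha] at this ⊢
  have hnonneg : ∀ θ, 0 ≤ Real.exp (-B * (1 - Real.cos θ)) * (1 - Real.cos (φ * (θ - Real.sin θ))) := fun θ =>
    mul_nonneg (Real.exp_nonneg _) (by linarith [Real.cos_le_one (φ * (θ - Real.sin θ))])
  calc ∫ θ in (-π)..π, Real.exp (-B * (1 - Real.cos θ)) * (1 - Real.cos (φ * (θ - Real.sin θ)))
      ≤ ∫ θ in (-π)..π, g θ := by
        refine intervalIntegral.integral_mono_on hle ?_ (hgi.intervalIntegrable) fun θ hθ => ?_
        · exact (by fun_prop : Continuous fun θ => Real.exp (-B * (1 - Real.cos θ)) *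
            (1 - Real.cos (φ * (θ - Real.sin θ)))).intervalIntegrable _ _
        · rcases eq_or_lt_of_le hθ.1 with h | h
          · -- the left endpoint: use continuity-free direct bound at `θ = -π`
            have habs : |θ| ≤ π := by rw [← h]; simp [abs_of_pos Real.pi_pos]
            refine (deficit_integrand_le hβ.le φ habs).trans ?_
            simp only [hg]
            refine mul_le_mul_of_nonneg_left ?_ (by positivity)
            have := pow_six_mul_exp_neg_le hapos θ
            rwa [ha] at this ⊢
          · exact hpt θ ⟨h, hθ.2⟩
    _ ≤ ∫ θ, g θ := by
        rw [intervalIntegral.integral_of_le hle]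
        exact setIntegral_le_integral hgi (Eventually.of_forall fun θ => by simp only [hg]; positivity)
    _ = φ ^ 2 / 72 * ((6 / (a * Real.exp 1)) ^ 3 * Real.sqrt (π / (a / 2))) := by
        simp only [hg, MeasureTheory.integral_const_mul]
        rw [integral_gaussian (a / 2)]
    _ = φ ^ 2 / 72 * ((6 / (2 * B / π ^ 2 * Real.exp 1)) ^ 3 * Real.sqrt (π / (2 * B / π ^ 2 / 2))) := by
        rw [ha]

/-! ### Positivity for `β ≥ 200` -/

/-- Numerical comparison of the deficit and the lower bound: for `B ≥ 200`,
`(φ²/72)(3π²/(eB))³ √(π³/B) ≤ e^{-1/2} √B⁻¹ · (1/2) · 2` in the precise form used below.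
[folklore] -/
theorem deficit_const_le {B φ : ℝ} (hB : 200 ≤ B) (hφ : φ ^ 2 ≤ B ^ 2) :
    φ ^ 2 / 72 * ((6 / (2 * B / π ^ 2 * Real.exp 1)) ^ 3 * Real.sqrt (π / (2 * B / π ^ 2 / 2))) ≤
      (1 / 2) * (2 * π * (Real.exp (-(1 / 2)) / (π * Real.sqrt B))) := by
  have hBpos : 0 < B := by linarith
  have hπ := Real.pi_pos
  have hπ3 : 3 < π := Real.pi_gt_three
  have hπ4 : π < 3.15 := Real.pi_lt_d2
  have he : (2.7:ℝ) < Real.exp 1 := by have := Real.exp_one_gt_d9; linarith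
  have he1 : 0 < Real.exp 1 := Real.exp_pos 1
  -- simplify the square roots: `√(π/(2B/π²/2)) = π √π / √B`
  have hsq : Real.sqrt (π / (2 * B / π ^ 2 / 2)) = π * Real.sqrt π / Real.sqrt B := by
    rw [show π / (2 * B / π ^ 2 / 2) = π ^ 2 * π / B by field_simp, Real.sqrt_div (by positivity),
      Real.sqrt_mul (by positivity), Real.sqrt_sq hπ.le]
  rw [hsq]
  -- reduce to a polynomial inequality in `π`, `e`, `√B`, `√π`
  have hsB : 0 < Real.sqrt B := Real.sqrt_pos.2 hBpos
  have hsπ : 0 < Real.sqrt π := Real.sqrt_pos.2 hπ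
  have hsπ2 : Real.sqrt π ≤ 1.8 := by
    rw [Real.sqrt_le_left (by norm_num)]
    nlinarith
  have hexp : (0.6:ℝ) ≤ Real.exp (-(1 / 2)) := by
    have h1 : Real.exp (1 / 2) ^ 2 = Real.exp 1 := by rw [← Real.exp_nat_mul]; norm_num
    have h2 : Real.exp 1 < 25 / 9 := lt_trans Real.exp_one_lt_d9 (by norm_num)
    have h3 : 0 < Real.exp (1 / 2) := Real.exp_pos _
    have h4 : Real.exp (1 / 2) ≤ 5 / 3 := by nlinarith
    rw [Real.exp_neg]
    rw [show (0.6:ℝ) = (5 / 3)⁻¹ by norm_num]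
    exact inv_anti₀ h3 h4
  -- `LHS = φ² · 27 π⁷ √π / (72 · e³ · B³ · √B)` and `RHS = e^{-1/2}/√B`
  have hL : φ ^ 2 / 72 * ((6 / (2 * B / π ^ 2 * Real.exp 1)) ^ 3 * (π * Real.sqrt π / Real.sqrt B)) =
      (27 * φ ^ 2 * π ^ 7 * Real.sqrt π / (72 * Real.exp 1 ^ 3 * B ^ 3)) / Real.sqrt B := by
    field_simp
    ring
  have hR : (1 / 2) * (2 * π * (Real.exp (-(1 / 2)) / (π * Real.sqrt B))) = Real.exp (-(1 / 2)) / Real.sqrt B := by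
    field_simp
  rw [hL, hR, div_le_div_iff_of_pos_right hsB]
  -- now `27 φ² π⁷ √π / (72 e³ B³) ≤ e^{-1/2}`; use `φ² ≤ B²`, `B ≥ 200`
  rw [div_le_iff₀ (by positivity)]
  have h1 : 27 * φ ^ 2 * π ^ 7 * Real.sqrt π ≤ 27 * B ^ 2 * 3.15 ^ 7 * 1.8 := by
    gcongr
  have h2 : (0.6:ℝ) * (72 * 2.7 ^ 3 * B ^ 3) ≤ Real.exp (-(1 / 2)) * (72 * Real.exp 1 ^ 3 * B ^ 3) := by
    gcongr
  have h3 : 27 * B ^ 2 * 3.15 ^ 7 * 1.8 ≤ (0.6:ℝ) * (72 * 2.7 ^ 3 * B ^ 3) := by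
    nlinarith [mul_nonneg (sq_nonneg B) (show (0:ℝ) ≤ B - 200 by linarith)]
  exact h1.trans (h3.trans h2)

/-- **`ampMax/2 ≤ amp` for `β ≥ 200`** (uniformly in `φ`). [cite: FrohlichSpencerKT1981, App. B (B.9)–(B.10) (uniformity in n)] -/
theorem half_ampMax_le_amp {β : ℝ} (hβ : 200 ≤ β) (φ : ℝ) : ampMax β φ / 2 ≤ amp β φ := by
  have hβpos : 0 < β := by linarith
  have hB : 200 ≤ bigB β φ := hβ.trans (le_bigB hβpos.le φ)
  have hB1 : 1 ≤ bigB β φ := by linarith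
  have hφ : φ ^ 2 ≤ bigB β φ ^ 2 := by
    rw [← sq_abs φ]; exact pow_le_pow_left₀ (abs_nonneg φ) (abs_le_bigB β φ) 2
  have h1 := ampMax_sub_amp_le hβpos φ
  have h2 := deficit_const_le hB hφ
  have h3 := ampMax_ge hB1
  have h4 : (2 * π)⁻¹ * (φ ^ 2 / 72 * ((6 / (2 * bigB β φ / π ^ 2 * Real.exp 1)) ^ 3 *
      Real.sqrt (π / (2 * bigB β φ / π ^ 2 / 2)))) ≤ ampMax β φ / 2 := by
    calc _ ≤ (2 * π)⁻¹ * ((1 / 2) * (2 * π * (Real.exp (-(1 / 2)) / (π * Real.sqrt (bigB β φ))))) :=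
          mul_le_mul_of_nonneg_left h2 (by positivity)
      _ = (Real.exp (-(1 / 2)) / (π * Real.sqrt (bigB β φ))) / 2 := by
          field_simp
      _ ≤ ampMax β φ / 2 := by linarith
  linarith

/-- **The amplitude is positive for `β ≥ 200`**, with the explicit lower bound
`e^{-1/2}/(2π√B) ≤ amp` (`β ≥ 200`). [cite: FrohlichSpencerKT1981, App. B (B.9)–(B.10)] -/
theorem amp_ge {β : ℝ} (hβ : 200 ≤ β) (φ : ℝ) :
    Real.exp (-(1 / 2)) / (2 * π * Real.sqrt (bigB β φ)) ≤ amp β φ := by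
  have hβpos : 0 < β := by linarith
  have hB1 : 1 ≤ bigB β φ := le_trans (by linarith) (le_bigB hβpos.le φ)
  have h := half_ampMax_le_amp hβ φ
  have h3 := ampMax_ge hB1
  have hπ := Real.pi_pos
  have hs : 0 < Real.sqrt (bigB β φ) := Real.sqrt_pos.2 (bigB_pos hβpos φ)
  calc Real.exp (-(1 / 2)) / (2 * π * Real.sqrt (bigB β φ))
      = (Real.exp (-(1 / 2)) / (π * Real.sqrt (bigB β φ))) / 2 := by field_simp
    _ ≤ ampMax β φ / 2 := by linarith
    _ ≤ amp β φ := h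

/-- **Positivity of the amplitude** (`β ≥ 200`). [folklore] -/
theorem amp_pos {β : ℝ} (hβ : 200 ≤ β) (φ : ℝ) : 0 < amp β φ := by
  have hs : 0 < Real.sqrt (bigB β φ) := Real.sqrt_pos.2 (bigB_pos (by linarith : (0:ℝ) < β) φ)
  exact (div_pos (Real.exp_pos _) (mul_pos (mul_pos two_pos Real.pi_pos) hs)).trans_le (amp_ge hβ φ)

/-- **Property (b): the Bessel interpolation is positive** (for all real `φ`, `β ≥ 200`; it is even
by `besselInterp_neg`). [cite: FrohlichSpencerKT1981, §6 property (b)] -/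
theorem besselInterp_pos {β : ℝ} (hβ : 200 ≤ β) (φ : ℝ) : 0 < besselInterp β φ :=
  mul_pos (Real.exp_pos _) (amp_pos hβ φ)

end BesselInterp

end Literature.Probability.LatticeModels
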